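import Literature.NumberTheory.NumberFields.QuarticCMFieldNonNormalNormalClosure
import Literature.NumberTheory.ComplexMultiplication.QuarticCMReflexSkewForm
import HarnessLib

/-!
# Shimura's Example (2)(C) data for an ARBITRARY non-normal quartic CM field inside `ℂ`: the bridge between the
# abstract dictionary (`QuarticCMGaloisDihedral`, `reflexField`) and the `normalClosure ℚ K ℂ` dictionary

[topic NumberTheory/ComplexMultiplication]

Layer `Literature/NumberTheory/ComplexMultiplication`; KERNEL ONLY (theorems; no definition, no named fact, net debt 0).
Lane `lit-deligne-2` (cell `pub-hodgecm2`), gen 51; count-neutral.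

TWO DICTIONARIES FOR ONE EXAMPLE.  The files `QuarticCMTypes`, `QuarticCMGaloisDihedral`, `QuarticCMReflexSkewForm` of this
directory (lane `lit-hodgefound`) type Shimura §8.4 Example (2)(C) for an ABSTRACT normal closure: `K` quartic CM
non-Galois, `L` any CM number field with `IsNormalClosure ℚ K L`, two embeddings `a, b : K →ₐ[ℚ] L` with `b ≠ a, ā`,
`σ, τ ∈ Gal(L/ℚ)` with `σ • a = b, σ • b = ρ • a, τ • a = b, τ • b = a` (the scoped action `g • χ = g ∘ χ` of
`EmbeddingAction`), the reflex field `reflexField ℚ L {a, b}`.  The file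
`NumberFields/QuarticCMFieldNonNormalNormalClosure.lean` (lane `lit-deligne-2`) types the same example for the CONCRETE
closure `N = normalClosure ℚ K ℂ ≤ ℂ`: a skew element `ξ` (`ξ̄ = −ξ ≠ 0`), complex embeddings `φ₀, φ₁ : K →ₐ[ℚ] ℂ` with
`φ₁ ξ ≠ ±φ₀ ξ`, the elements `x₀ = φ₀ ξ, x₁ = φ₁ ξ ∈ N`, and subfields of `N` as `IntermediateField`s (`ℚ⟮x₀ + x₁⟯`, …).
`NonGaloisQuarticCMFieldShimuraData.lean` joins the two for the single field `K = ℚ(√(−(3+√2)))`.  THIS FILE joins them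
for every `K`:

* `isNormalClosure_normalClosure_complex`, `numberField_normalClosure_complex` — `N = normalClosure ℚ K ℂ` is a normal
  closure of `K` and a number field (so the abstract theorems apply with `L = N`; `[IsCMField N]` is the tree's
  `isCMField_normalClosure`);
* **`exists_shimura_data`** — for `ξ, φ₀, φ₁, x₀, x₁` as above there are `a, b : K →ₐ[ℚ] N` with `a ξ = x₀`, `b ξ = x₁`,
  `b ≠ a`, `b ≠ ρ • a`, and `σ, τ ∈ Gal(N/ℚ)` with `σ • a = b, σ • b = ρ • a, τ • a = b, τ • b = a`, acting by
  `σ : x₀ ↦ x₁ ↦ −x₀` (the `r` of `IsCMField.exists_dihedral_generators_gal_normalClosure`) and `τ : x₀ ↦ x₁ ↦ x₀`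
  (its `rs`);
* **`exists_pair_reflexField_eq_adjoin_add`** — for such `a, b`: **`reflexField ℚ N {a, b} = ℚ⟮x₀ + x₁⟯`**, i.e. the
  abstract reflex field IS Shimura's field `ℚ(ξ + ξ^φ)` of `QuarticCMFieldNonNormalNormalClosure` §8 (so that file's
  §8–§9, §12 statements about `ℚ⟮x₀ + x₁⟯` — degree `4`, CM, `≇ K`, same Galois closure, one of the five quartic
  subfields — are statements about `reflexField ℚ N {a, b}`, and conversely `QuarticCMDihedral.isPrimitive_pair`,
  `reflexType_pair_eq`, … apply to the concrete data); `reflexField_eq_adjoin_add` (the same for ANY such `{a, b}`),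
  `mem_reflexField_iff` — its image in `ℂ` is `ℚ⟮φ₀ ξ + φ₁ ξ⟯`;
* first transports: **`isPrimitive_pair`** (every CM type `{a, b}` valued in `N` with `a ξ = x₀, b ξ = x₁` is primitive —
  «which proves that (K; {1, φ}) is primitive») and **`isCMField_adjoin_add`** (`ℚ⟮x₀ + x₁⟯ ≤ N` is a CM field, Prop. 28).

## References

* [Shimura1998] G. Shimura, *Abelian Varieties with Complex Multiplication and Modular Functions*, Princeton 1998,
  §8.4 Example (2)(C) («Denote by σ and τ respectively the elements of G which send (ξ, ξ^φ) onto (ξ^φ, −ξ) and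
  (ξ^φ, ξ) … the subfield of L corresponding to H* is ℚ(ξ + ξ^φ)»).
* [Streng2010] M. Streng, *Complex multiplication of abelian surfaces*, thesis, Leiden 2010, Ch. I Lemma 3.4 (3),
  Example 7.5 (p. 31: «the reflex field K^r of Φ is the fixed field of ⟨rs⟩»).
-/

noncomputable section

open Polynomial Complex IntermediateField Module NumberField
open scoped Pointwise ComplexConjugate

namespace Literature.NumberTheory.ComplexMultiplication

open Literature.NumberTheory.NumberFields

namespace QuarticCMShimuraDataComplex

variable (K : Type) [Field K] [NumberField K]

/-- `N = normalClosure ℚ K ℂ` is a normal closure of the number field `K` over `ℚ` (all minimal polynomials split in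
`ℂ`; Streng, proof of Lemma I.3.4 (3): «Let L be the normal closure of K»; Shimura: «Put now L = ℚ(ξ, ξ^φ); then we
see that L is normal over ℚ»). [cite: Streng2010, Ch. I Lemma 3.4 (3), proof (p. 21)] [cite: Shimura1998, §8.4 Example (2)(C)] -/
theorem isNormalClosure_normalClosure_complex : IsNormalClosure ℚ K (normalClosure ℚ K ℂ) :=
  Algebra.IsAlgebraic.isNormalClosure_normalClosure fun _ => IsAlgClosed.splits _

/-- The normal closure of a number field inside `ℂ` is a number field (Streng, proof of Lemma I.3.4 (3): «Let L be the
normal closure of K»). [cite: Streng2010, Ch. I Lemma 3.4 (3), proof (p. 21)] -/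
theorem numberField_normalClosure_complex : NumberField (normalClosure ℚ K ℂ) :=
  { to_charZero := inferInstance, to_finiteDimensional := inferInstance }

variable [IsCMField K] (h4 : finrank ℚ K = 4) (hK : ¬ IsGalois ℚ K) {ξ : K} (hξ : IsCMField.complexConj K ξ = -ξ)
  (hξ0 : ξ ≠ 0) (φ₀ φ₁ : K →ₐ[ℚ] ℂ) (h₁ : φ₁ ξ ≠ φ₀ ξ) (h₁' : φ₁ ξ ≠ -φ₀ ξ)
  {x₀ x₁ : normalClosure ℚ K ℂ} (hx₀ : (x₀ : ℂ) = φ₀ ξ) (hx₁ : (x₁ : ℂ) = φ₁ ξ)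
include h4 hK hξ hξ0 h₁ h₁' hx₀ hx₁

/-- **Shimura's data on `N = normalClosure ℚ K ℂ`.**  For a skew element `ξ` of the non-normal quartic CM field `K`
and complex embeddings `φ₀, φ₁` with `φ₁ ξ ≠ ±φ₀ ξ` (`x₀ = φ₀ ξ`, `x₁ = φ₁ ξ ∈ N`): embeddings `a, b : K → N` with
`a ξ = x₀`, `b ξ = x₁`, `b ≠ a`, `b ≠ ρ • a`, and `σ, τ ∈ Gal(N/ℚ)` with `σ ∘ a = b`, `σ ∘ b = ρ ∘ a`, `τ ∘ a = b`,
`τ ∘ b = a` («σ and τ send the couple (ξ, ξ^φ) onto (ξ^φ, −ξ) and (ξ^φ, ξ)»), acting by `σ : x₀ ↦ x₁ ↦ −x₀`,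
`τ : x₀ ↦ x₁ ↦ x₀`.  The instance hypothesis `[IsCMField N]` is the tree's `isCMField_normalClosure K`,
`[NumberField N]` is `numberField_normalClosure_complex K`.
[cite: Shimura1998, §8.4 Example (2)(C)] [cite: Streng2010, Ch. I Example 7.5 (p. 31)] -/
theorem exists_shimura_data [NumberField (normalClosure ℚ K ℂ)] [IsCMField (normalClosure ℚ K ℂ)] :
    ∃ (a b : K →ₐ[ℚ] normalClosure ℚ K ℂ) (σ τ : normalClosure ℚ K ℂ ≃ₐ[ℚ] normalClosure ℚ K ℂ),
      a ξ = x₀ ∧ b ξ = x₁ ∧ b ≠ a ∧ b ≠ conjGal (L := normalClosure ℚ K ℂ) • a ∧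
      (σ • a = b ∧ σ • b = conjGal (L := normalClosure ℚ K ℂ) • a) ∧ (τ • a = b ∧ τ • b = a) ∧
      σ x₀ = x₁ ∧ σ x₁ = -x₀ ∧ τ x₀ = x₁ ∧ τ x₁ = x₀ := by
  -- the embeddings `φ₀, φ₁`, co-restricted to `N ⊇ φᵢ(K)`
  have hr₀ : ∀ y, φ₀ y ∈ (normalClosure ℚ K ℂ).toSubalgebra := fun y => φ₀.fieldRange_le_normalClosure ⟨y, rfl⟩
  have hr₁ : ∀ y, φ₁ y ∈ (normalClosure ℚ K ℂ).toSubalgebra := fun y => φ₁.fieldRange_le_normalClosure ⟨y, rfl⟩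
  let a : K →ₐ[ℚ] normalClosure ℚ K ℂ := AlgHom.codRestrict φ₀ (normalClosure ℚ K ℂ).toSubalgebra hr₀
  let b : K →ₐ[ℚ] normalClosure ℚ K ℂ := AlgHom.codRestrict φ₁ (normalClosure ℚ K ℂ).toSubalgebra hr₁
  have ha : a ξ = x₀ := Subtype.ext (show φ₀ ξ = (x₀ : ℂ) from hx₀.symm)
  have hb : b ξ = x₁ := Subtype.ext (show φ₁ ξ = (x₁ : ℂ) from hx₁.symm)
  obtain ⟨σ, hσa, hσb⟩ := IsCMField.exists_gal_apply_pair_eq K h4 hK hξ hξ0 φ₀ φ₁ h₁ h₁' hx₀ hx₁ x₁ (-x₀)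
    (Or.inr ⟨Or.inl rfl, Or.inr rfl⟩)
  obtain ⟨τ, hτa, hτb⟩ := IsCMField.exists_gal_apply_pair_eq K h4 hK hξ hξ0 φ₀ φ₁ h₁ h₁' hx₀ hx₁ x₁ x₀
    (Or.inr ⟨Or.inl rfl, Or.inl rfl⟩)
  -- complex conjugation `ρ` of `N` acts on `N ⊂ ℂ` by `conj`, hence `ρ x₀ = −x₀`
  have hρ : ∀ x : normalClosure ℚ K ℂ,
      ((conjGal (L := normalClosure ℚ K ℂ) x : normalClosure ℚ K ℂ) : ℂ) = conj (x : ℂ) :=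
    fun x => IsCMField.complexEmbedding_complexConj (normalClosure ℚ K ℂ) (algebraMap (normalClosure ℚ K ℂ) ℂ) x
  have hρa : conjGal (L := normalClosure ℚ K ℂ) x₀ = -x₀ := Subtype.ext (by
    rw [hρ]; push_cast; rw [hx₀]; exact IsCMField.conj_apply_of_complexConj_eq_neg K hξ φ₀)
  -- an embedding `K → N` is determined by its value at `ξ` (`K = ℚ(ξ)`)
  have hext : ∀ {f g : K →ₐ[ℚ] normalClosure ℚ K ℂ}, f ξ = g ξ → f = g := by
    intro f g hfg
    have htop := IsCMField.adjoin_simple_eq_top_of_complexConj_eq_neg K h4 hK hξ hξ0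
    apply AlgHom.ext
    intro y
    have hy : y ∈ IntermediateField.adjoin ℚ {ξ} := by rw [htop]; exact IntermediateField.mem_top
    induction hy using IntermediateField.adjoin_induction with
    | mem z hz => rw [Set.mem_singleton_iff] at hz; subst hz; exact hfg
    | algebraMap q => rw [AlgHom.commutes, AlgHom.commutes]
    | add z w _ _ hz hw => rw [map_add, map_add, hz, hw]
    | mul z w _ _ hz hw => rw [map_mul, map_mul, hz, hw]
    | inv z _ hz => rw [map_inv₀, map_inv₀, hz]
  have hba : x₁ ≠ x₀ := fun h => h₁ (by rw [← hx₀, ← hx₁, h])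
  have hba' : x₁ ≠ -x₀ := fun h => h₁' (by rw [← hx₀, ← hx₁, h]; rfl)
  refine ⟨a, b, σ, τ, ha, hb, ?_, ?_, ⟨?_, ?_⟩, ⟨?_, ?_⟩, hσa, hσb, hτa, hτb⟩
  · intro h
    exact hba (by rw [← ha, ← hb, h])
  · intro h
    apply hba'
    rw [← hb, h, algEquiv_smul_apply, ha, hρa]
  · exact hext (by rw [algEquiv_smul_apply, ha, hσa, hb])
  · exact hext (by rw [algEquiv_smul_apply, hb, hσb, algEquiv_smul_apply, ha, hρa])
  · exact hext (by rw [algEquiv_smul_apply, ha, hτa, hb])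
  · exact hext (by rw [algEquiv_smul_apply, hb, hτb, ha])

/-- **The abstract reflex field is Shimura's `ℚ(ξ + ξ^φ)`**: for the CM type `{a, b}` of `K` valued in
`N = normalClosure ℚ K ℂ` with `a ξ = x₀ = φ₀ ξ`, `b ξ = x₁ = φ₁ ξ`, **`reflexField ℚ N {a, b} = ℚ⟮x₀ + x₁⟯`** — the
field of `QuarticCMFieldNonNormalNormalClosure` §8 (`IsCMField.fixedField_zpowers_eq_adjoin_add`: the fixed field of
`⟨rs⟩`), via the abstract `QuarticCMDihedral.reflexField_pair_eq_adjoin` («the subfield of L corresponding to H* is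
ℚ(ξ + ξ^φ)»). [cite: Shimura1998, §8.4 Example (2)(C)] [cite: Streng2010, Ch. I Example 7.5 (p. 31)] -/
theorem exists_pair_reflexField_eq_adjoin_add [NumberField (normalClosure ℚ K ℂ)] [IsCMField (normalClosure ℚ K ℂ)] :
    ∃ a b : K →ₐ[ℚ] normalClosure ℚ K ℂ,
      a ξ = x₀ ∧ b ξ = x₁ ∧ b ≠ a ∧ b ≠ conjGal (L := normalClosure ℚ K ℂ) • a ∧
      reflexField ℚ (normalClosure ℚ K ℂ) ({a, b} : Set (K →ₐ[ℚ] normalClosure ℚ K ℂ)) = ℚ⟮x₀ + x₁⟯ := by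
  haveI : IsNormalClosure ℚ K (normalClosure ℚ K ℂ) := isNormalClosure_normalClosure_complex K
  obtain ⟨a, b, σ, τ, ha, hb, hba, hbc, hσ, hτ, -⟩ := exists_shimura_data K h4 hK hξ hξ0 φ₀ φ₁ h₁ h₁' hx₀ hx₁
  refine ⟨a, b, ha, hb, hba, hbc, ?_⟩
  rw [QuarticCMDihedral.reflexField_pair_eq_adjoin h4 hba hbc hσ hτ hξ hξ0, ha, hb]

/-- For ANY CM type `{a, b}` of `K` valued in `N` with `a ξ = x₀`, `b ξ = x₁` (not only the one produced above):
`reflexField ℚ N {a, b} = ℚ⟮x₀ + x₁⟯`. [cite: Shimura1998, §8.4 Example (2)(C)] -/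
theorem reflexField_eq_adjoin_add [NumberField (normalClosure ℚ K ℂ)] [IsCMField (normalClosure ℚ K ℂ)]
    {a b : K →ₐ[ℚ] normalClosure ℚ K ℂ} (ha : a ξ = x₀) (hb : b ξ = x₁) :
    reflexField ℚ (normalClosure ℚ K ℂ) ({a, b} : Set (K →ₐ[ℚ] normalClosure ℚ K ℂ)) = ℚ⟮x₀ + x₁⟯ := by
  haveI : IsNormalClosure ℚ K (normalClosure ℚ K ℂ) := isNormalClosure_normalClosure_complex K
  -- `b ≠ a, ā` from `x₁ ≠ ±x₀`
  have hρ : ∀ x : normalClosure ℚ K ℂ,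
      ((conjGal (L := normalClosure ℚ K ℂ) x : normalClosure ℚ K ℂ) : ℂ) = conj (x : ℂ) :=
    fun x => IsCMField.complexEmbedding_complexConj (normalClosure ℚ K ℂ) (algebraMap (normalClosure ℚ K ℂ) ℂ) x
  have hρa : conjGal (L := normalClosure ℚ K ℂ) x₀ = -x₀ := Subtype.ext (by
    rw [hρ]; push_cast; rw [hx₀]; exact IsCMField.conj_apply_of_complexConj_eq_neg K hξ φ₀)
  have hba : b ≠ a := fun h => h₁ (by rw [← hx₀, ← hx₁, ← ha, ← hb, h])
  have hbc : b ≠ conjGal (L := normalClosure ℚ K ℂ) • a := fun h => h₁' (by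
    rw [← hx₀, ← hx₁, ← hb, h, algEquiv_smul_apply, ha, hρa]; rfl)
  obtain ⟨σ, τ, hσ, hτ⟩ := QuarticCMDihedral.exists_sigma_tau h4 hK hba hbc
  rw [QuarticCMDihedral.reflexField_pair_eq_adjoin h4 hba hbc hσ hτ hξ hξ0, ha, hb]

/-- **In `ℂ`: the reflex field is `ℚ(φ₀ ξ + φ₁ ξ)`** — an element of `N` lies in `reflexField ℚ N {a, b}` iff, as a
complex number, it lies in `ℚ(φ₀ ξ + φ₁ ξ)` (the field of `QuarticCMFieldNonNormalNormalClosure` §8–§9: a quartic CM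
field, not normal, with no `ℚ`-algebra maps to or from `K`, and the same Galois closure `N`).
[cite: Shimura1998, §8.4 Example (2)(C)] -/
theorem mem_reflexField_iff [NumberField (normalClosure ℚ K ℂ)] [IsCMField (normalClosure ℚ K ℂ)]
    {a b : K →ₐ[ℚ] normalClosure ℚ K ℂ} (ha : a ξ = x₀) (hb : b ξ = x₁) (z : normalClosure ℚ K ℂ) :
    z ∈ reflexField ℚ (normalClosure ℚ K ℂ) ({a, b} : Set (K →ₐ[ℚ] normalClosure ℚ K ℂ)) ↔
      (z : ℂ) ∈ ℚ⟮φ₀ ξ + φ₁ ξ⟯ := by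
  rw [reflexField_eq_adjoin_add K h4 hK hξ hξ0 φ₀ φ₁ h₁ h₁' hx₀ hx₁ ha hb]
  have hc : ((x₀ + x₁ : normalClosure ℚ K ℂ) : ℂ) = φ₀ ξ + φ₁ ξ := by push_cast; rw [hx₀, hx₁]
  have hlift : IntermediateField.lift ℚ⟮x₀ + x₁⟯ = ℚ⟮φ₀ ξ + φ₁ ξ⟯ := (lift_adjoin_simple _ _ _).trans (by rw [hc])
  rw [← hlift]
  exact (IntermediateField.mem_lift z).symm

omit hξ0 in
/-- **Every CM type `{a, b}` of `K` valued in `N` with `a ξ = x₀`, `b ξ = x₁` is primitive** — Shimura's «which proves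
that (K; {1, φ}) is primitive», the abstract `QuarticCMDihedral.isPrimitive_pair` on the concrete data.
[cite: Shimura1998, §8.4 Example (2)(C)] -/
theorem isPrimitive_pair [NumberField (normalClosure ℚ K ℂ)] [IsCMField (normalClosure ℚ K ℂ)]
    {a b : K →ₐ[ℚ] normalClosure ℚ K ℂ} (ha : a ξ = x₀) (hb : b ξ = x₁) :
    IsPrimitive (normalClosure ℚ K ℂ ≃ₐ[ℚ] normalClosure ℚ K ℂ) ({a, b} : Set (K →ₐ[ℚ] normalClosure ℚ K ℂ)) a := by
  haveI : IsNormalClosure ℚ K (normalClosure ℚ K ℂ) := isNormalClosure_normalClosure_complex K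
  have hρ : ∀ x : normalClosure ℚ K ℂ,
      ((conjGal (L := normalClosure ℚ K ℂ) x : normalClosure ℚ K ℂ) : ℂ) = conj (x : ℂ) :=
    fun x => IsCMField.complexEmbedding_complexConj (normalClosure ℚ K ℂ) (algebraMap (normalClosure ℚ K ℂ) ℂ) x
  have hρa : conjGal (L := normalClosure ℚ K ℂ) x₀ = -x₀ := Subtype.ext (by
    rw [hρ]; push_cast; rw [hx₀]; exact IsCMField.conj_apply_of_complexConj_eq_neg K hξ φ₀)
  have hba : b ≠ a := fun h => h₁ (by rw [← hx₀, ← hx₁, ← ha, ← hb, h])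
  have hbc : b ≠ conjGal (L := normalClosure ℚ K ℂ) • a := fun h => h₁' (by
    rw [← hx₀, ← hx₁, ← hb, h, algEquiv_smul_apply, ha, hρa]; rfl)
  obtain ⟨σ, τ, hσ, hτ⟩ := QuarticCMDihedral.exists_sigma_tau h4 hK hba hbc
  exact QuarticCMDihedral.isPrimitive_pair h4 hba hbc hσ hτ

/-- **`ℚ(x₀ + x₁) ≤ N` is a CM field** (Prop. 28: the reflex field is CM; `QuarticCMDihedral.isCMField_reflexField_pair`
transported along `reflexField_eq_adjoin_add`) — the `N`-level companion of
`IsCMField.isCMField_adjoin_apply_add_apply` (`ℚ(φ₀ ξ + φ₁ ξ) ≤ ℂ` is CM). [cite: Shimura1998, §8.3 Prop. 28, §8.4 Example (2)(C)] -/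
theorem isCMField_adjoin_add [NumberField (normalClosure ℚ K ℂ)] [IsCMField (normalClosure ℚ K ℂ)] :
    IsCMField ℚ⟮x₀ + x₁⟯ := by
  haveI : IsNormalClosure ℚ K (normalClosure ℚ K ℂ) := isNormalClosure_normalClosure_complex K
  obtain ⟨a, b, ha, hb, -, hbc, heq⟩ := exists_pair_reflexField_eq_adjoin_add K h4 hK hξ hξ0 φ₀ φ₁ h₁ h₁' hx₀ hx₁
  have h := QuarticCMDihedral.isCMField_reflexField_pair (K := K) hbc
  rw [heq] at h
  exact h

end QuarticCMShimuraDataComplex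

end Literature.NumberTheory.ComplexMultiplication

end
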